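import Summits.AtomisticToContinuum.HydrodynamicLimit.Theorems.OddContactSymmetry.Negative.MixtureObstruction
import Summits.AtomisticToContinuum.HydrodynamicLimit.Theorems.OddContactSymmetry.Negative.ParityExactWeights
import Literature.MathematicalPhysics.KineticTheory.HardSphereEulerProofs

/-!
# Negative knowledge for crux `JParityClosure.OddContactSymmetry` (stmt-AtomisticToContinuum-17722, rev 5):
# the Metropolis weight does NOT remove the `r`-ball mixture obstruction — `r₀` must depend on `η`

Standing disprover `refuter-cdisprove-stmt-AtomisticToContinuum-17722-0` (cycle 1, 2026-08-17), companion of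
`Cruxes/OddContactSymmetry/Disproof.lean` §9.  The rev-5 crux weights every ordered contact pair by the Metropolis
acceptance `min 1 (e^{−F})`; in the dictionary of `ParityExactWeights` (`a` = incoming pair density at the collision
parameter `q`, `a′` at the inverse collision `J q`, `b = h(v)h(w)`, `b′ = h(v′)h(w′)`, `h` the `(r,ϑ)`-mollified one-body
law) its `J`-odd pair residual is `a·min(1, b′/b) − a′·min(1, b/b′) = (a b′ − a′ b)/max(b, b′)` (`metropolis_residual`).
The LIMIT CONTENT of the crux at FIXED `(r, ϑ)` is the vanishing of this residual against every odd mark.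

`not_metropolisBalance_for_mixtures` (this file): that fixed-`(r,ϑ)` content is FALSE already under PERFECT local
equilibrium (`a = a′`, a chaotic one-temperature Maxwellian pair law) as soon as the mollified law `h` is a genuine
two-temperature mixture — an `r`-ball straddling thermal structure finer than `r` (witness of `MixtureObstruction`:
`θ₁ = 1, θ₂ = 2`, `n̂ = −e₀`, `v = e₀ + e₁`, `w = 0`, energies `(2,0) ↦ (1,1)`): the residual is `a (b′ − b)/max(b,b′) ≠ 0`.
Consequences for the provers (load-bearing analysis of the rev-5 quantifier order):
* the strengthening "`∃ r₀` BEFORE `∀ η`" (a fixed mollification scale) of `OddContactSymmetry` is false for every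
  non-constant smooth temperature profile — the limit statistic at fixed `r` is `σ³·O((r∇θ/θ)²) ≠ 0` (refuter-rattack MC,
  item evidence `metropolis_bias_mc2.py`: `κ = r∇θ/θ = .05/.1/.2/.4 ↦ −3.6e-4/−1.4e-3/−5.5e-3/−2.0e-2`); the filed order
  `∀ η δ, ∃ r₀(η,δ)` is load-bearing, and `γ̄_a = 0` may only be read off AFTER `r → 0`;
* the Metropolis repair changed the SIZE of the mixture defect (bounded by `1`, it can no longer blow up) but not its
  presence: `min` is parity-exact (`parityExact_min`), so its residual vanishes iff `a b′ = a′ b` exactly like the retired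
  weight `1 + e^{−F}` (`reweighted_odd_residual_eq_zero_iff`).
-/

noncomputable section

open scoped InnerProductSpace

namespace Summit.AtomisticToContinuum.HydrodynamicLimit.Theorems

namespace OddContactSymmetryNegative

open Literature.Analysis.FluidPDE Literature.MathematicalPhysics.KineticTheory

/-- **The Metropolis residual of a chaotic pair law against a two-temperature mollified law is non-zero on the witness
collision.**  With `h = M_{θ₁} + M_{θ₂}` (`θ₁ ≠ θ₂`), pre-energies `(2c, 0)`, post-energies `(c, c)` (`c ≠ 0`) and ANY
incoming density `a > 0` equal at `q` and `J q` (perfect local equilibrium), `a·min(1, b′/b) − a·min(1, b/b′) ≠ 0`.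
[folklore] -/
theorem metropolis_residual_ne_zero_of_mixture {θ₁ θ₂ c a : ℝ} (h₁ : 0 < θ₁) (h₂ : 0 < θ₂) (hne : θ₁ ≠ θ₂)
    (hc : c ≠ 0) (ha : 0 < a) (v w v' w' : V3)
    (hv : ‖v‖ ^ 2 = 2 * c) (hw : ‖w‖ ^ 2 = 0) (hv' : ‖v'‖ ^ 2 = c) (hw' : ‖w'‖ ^ 2 = c) :
    let h : V3 → ℝ := fun u => localMaxwellian 1 θ₁ (0 : V3) u + localMaxwellian 1 θ₂ (0 : V3) u
    a * min 1 (h v' * h w' / (h v * h w)) - a * min 1 (h v * h w / (h v' * h w')) ≠ 0 := by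
  intro h
  have hpos : ∀ u, 0 < h u := fun u =>
    add_pos (localMaxwellian_pos one_pos h₁ (0 : V3) u) (localMaxwellian_pos one_pos h₂ (0 : V3) u)
  have hb : 0 < h v * h w := mul_pos (hpos v) (hpos w)
  have hb' : 0 < h v' * h w' := mul_pos (hpos v') (hpos w')
  have hlt : h v' * h w' < h v * h w :=
    mixture_mollifier_breaks_twisted_balance h₁ h₂ hne hc v w v' w' hv hw hv' hw'
  rw [metropolis_residual a a hb hb']
  have hnum : a * (h v' * h w') - a * (h v * h w) < 0 := by nlinarith
  have hden : 0 < max (h v * h w) (h v' * h w') := lt_max_of_lt_left hb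
  exact (div_neg_of_neg_of_pos hnum hden).ne

/-- **Refuted strengthening (rev 5): Metropolis twisted balance does not hold at fixed mollification scale.**  "For every
two-temperature mollified law and every chaotic incoming density `a > 0` the Metropolis pair residual vanishes on every
collision" is false: `θ₁ = 1, θ₂ = 2`, `a = 1`, `n = −e₀`, `v = e₀ + e₁`, `w = 0`.  Hence the `r₀`-before-`η` strengthening
of `OddContactSymmetry` (rev 5) fails against perfectly chaotic local-Maxwellian pair laws; only the `r → 0` passage AFTER
`N → ∞` (the filed order `∀ η δ, ∃ r₀`) carries the crux — the Metropolis weight bounds the mixture defect by `1` but does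
not remove it. [folklore] -/
theorem not_metropolisBalance_for_mixtures :
    ¬ (∀ θ₁ θ₂ : ℝ, 0 < θ₁ → 0 < θ₂ → ∀ a : ℝ, 0 < a → ∀ n v w : V3,
        let h : V3 → ℝ := fun u => localMaxwellian 1 θ₁ (0 : V3) u + localMaxwellian 1 θ₂ (0 : V3) u
        a * min 1 (h (reflectVel n (v, w)).1 * h (reflectVel n (v, w)).2 / (h v * h w)) -
            a * min 1 (h v * h w / (h (reflectVel n (v, w)).1 * h (reflectVel n (v, w)).2)) = 0) := by
  intro H
  obtain ⟨_, _, hrefl, hv, hw, h1, h0⟩ := mixture_witness_geometry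
  set e₀ : V3 := EuclideanSpace.single (0 : Fin 3) (1 : ℝ)
  set e₁ : V3 := EuclideanSpace.single (1 : Fin 3) (1 : ℝ)
  have heq := H 1 2 one_pos two_pos 1 one_pos (-e₀) (e₀ + e₁) 0
  simp only [hrefl] at heq
  exact metropolis_residual_ne_zero_of_mixture (θ₁ := 1) (θ₂ := 2) one_pos two_pos (by norm_num)
    (c := 1) one_ne_zero one_pos (e₀ + e₁) 0 e₁ e₀ hv hw h1 h0 heq

end OddContactSymmetryNegative

end Summit.AtomisticToContinuum.HydrodynamicLimit.Theorems

end
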